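import Summits.KontsevichZagierPeriods.KontsevichZagierPeriods.Theorems.MultiplicationAccessible.Negative.Core
import Literature.NumberTheory.Transcendental.KZLogCalculusProofs
import Literature.NumberTheory.Transcendental.KZSubcalculusInvariants
import Literature.NumberTheory.Transcendental.KZProductIdeal

/-!
# `MultiplicationAccessible` (stmt-KontsevichZagierPeriods-12305), line `shifted-family-prime-sieve`:
the ROTATION AVERAGE at `p = 3` — `[box, g₀ f_x] ∼ [box, f_x]`

First move-level piece of the Liouville rotation flow for the registered stub `stub_gmThreeShifted`
(idea card `liouville-rotation-flow`, design `CornerP3Design.md` in the crux evidence). With the shifted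
integrand `f_x(t) = ∏_(k<3) t_k^(x+k/3−1)(1−t_k)^(s−1)` on the open box `(0,1)³`, the geometric mean
`ζ = (t₀t₁t₂)^(1/3)`, the monomials `m₁ = t₀/ζ`, `m₂ = t₀t₁/ζ²` and `g₀ = (1 + m₁ + m₂)/3`, the cyclic
rotation `τ : t ↦ (t₁, t₂, t₀)` satisfies `f_x ∘ τ = m₁ f_x`, `f_x ∘ τ² = m₂ f_x` (`Rotation.comp_eq_one`,
`Rotation.comp_eq_two`: rational-exponent book-keeping), so

  `[box, g₀ f_x] ∼ [box, f_x]`   (`rotationAverageThree`, registered sub-goal)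

by two changes of variables (the coordinate rotations, `KZ.of_sub_of_reindex_mem_relations`), three
integrand-additivity moves and `[σ, 3·(f/3)] ≡ 3·[σ, f/3]` (`KZ.IntegralRep.of_constMul_nat_sub_nsmul_mem_relations`).
This is the "un-symmetrising" step that identifies the graph term `a(z)dz∧Ξ|_(z = z(t)) = g₀ f_x dt` of
the Stokes region with the shifted box. References: Andrews–Askey–Roy 1999 pp. 30–31; Kontsevich–Zagier 2001 §1.2.
-/

noncomputable section

open MeasureTheory Set Real
open scoped BigOperators
open Literature.NumberTheory.Transcendental
open Literature.NumberTheory.Transcendental.KZ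
open Summit.KontsevichZagierPeriods.MultiplicationAccessible.Negative (boxDom isSemialgebraic_boxDom)

namespace Summit.KontsevichZagierPeriods.TerasomaMultiplication.MultiplicationAccessible

namespace Rotation

/-- `(t₀t₁t₂)^(1/3) = t₀^(1/3) t₁^(1/3) t₂^(1/3)` for positive reals. [folklore] -/
theorem geomMean_eq {t0 t1 t2 : ℝ} (h0 : 0 < t0) (h1 : 0 < t1) (h2 : 0 < t2) :
    (t0 * t1 * t2) ^ ((1:ℝ)/3) = t0 ^ ((1:ℝ)/3) * t1 ^ ((1:ℝ)/3) * t2 ^ ((1:ℝ)/3) := by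
  rw [mul_rpow (by positivity) h2.le, mul_rpow h0.le h1.le]

/-- **`f_x ∘ τ = m₁ · f_x`** written out: `(t₀/ζ) · f_x(t₀,t₁,t₂) = f_x(t₁,t₂,t₀)`, `ζ = (t₀t₁t₂)^(1/3)`.
[cite: AndrewsAskeyRoy1999, Thm 1.5.2] -/
theorem comp_eq_one {t0 t1 t2 : ℝ} (x s : ℝ) (h0 : 0 < t0) (h1 : 0 < t1) (h2 : 0 < t2) :
    t0 / (t0 * t1 * t2) ^ ((1:ℝ)/3) *
      (t0 ^ (x - 1) * (1 - t0) ^ (s - 1) * (t1 ^ (x + 1/3 - 1) * (1 - t1) ^ (s - 1)) *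
        (t2 ^ (x + 2/3 - 1) * (1 - t2) ^ (s - 1))) =
    t1 ^ (x - 1) * (1 - t1) ^ (s - 1) * (t2 ^ (x + 1/3 - 1) * (1 - t2) ^ (s - 1)) *
      (t0 ^ (x + 2/3 - 1) * (1 - t0) ^ (s - 1)) := by
  set u0 := (1 - t0) ^ (s - 1)
  set u1 := (1 - t1) ^ (s - 1)
  set u2 := (1 - t2) ^ (s - 1)
  have k0 : t0 * t0 ^ (x - 1) = t0 ^ (x + 2/3 - 1) * t0 ^ ((1:ℝ)/3) := by
    rw [← rpow_add h0, mul_comm, ← rpow_add_one h0.ne']; ring_nf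
  have k1 : t1 ^ (x + 1/3 - 1) = t1 ^ (x - 1) * t1 ^ ((1:ℝ)/3) := by
    rw [← rpow_add h1]; ring_nf
  have k2 : t2 ^ (x + 2/3 - 1) = t2 ^ (x + 1/3 - 1) * t2 ^ ((1:ℝ)/3) := by
    rw [← rpow_add h2]; ring_nf
  have hp0 : 0 < t0 ^ ((1:ℝ)/3) := rpow_pos_of_pos h0 _
  have hp1 : 0 < t1 ^ ((1:ℝ)/3) := rpow_pos_of_pos h1 _
  have hp2 : 0 < t2 ^ ((1:ℝ)/3) := rpow_pos_of_pos h2 _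
  rw [geomMean_eq h0 h1 h2, div_mul_eq_mul_div, div_eq_iff (by positivity)]
  calc t0 * (t0 ^ (x - 1) * u0 * (t1 ^ (x + 1/3 - 1) * u1) * (t2 ^ (x + 2/3 - 1) * u2))
      = (t0 * t0 ^ (x - 1)) * t1 ^ (x + 1/3 - 1) * t2 ^ (x + 2/3 - 1) * (u0 * u1 * u2) := by ring
    _ = (t0 ^ (x + 2/3 - 1) * t0 ^ ((1:ℝ)/3)) * (t1 ^ (x - 1) * t1 ^ ((1:ℝ)/3)) *
          (t2 ^ (x + 1/3 - 1) * t2 ^ ((1:ℝ)/3)) * (u0 * u1 * u2) := by rw [k0, k1, k2]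
    _ = _ := by ring

/-- **`f_x ∘ τ² = m₂ · f_x`** written out: `(t₀t₁/ζ²) · f_x(t₀,t₁,t₂) = f_x(t₂,t₀,t₁)`.
[cite: AndrewsAskeyRoy1999, Thm 1.5.2] -/
theorem comp_eq_two {t0 t1 t2 : ℝ} (x s : ℝ) (h0 : 0 < t0) (h1 : 0 < t1) (h2 : 0 < t2) :
    t0 * t1 / ((t0 * t1 * t2) ^ ((1:ℝ)/3)) ^ 2 *
      (t0 ^ (x - 1) * (1 - t0) ^ (s - 1) * (t1 ^ (x + 1/3 - 1) * (1 - t1) ^ (s - 1)) *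
        (t2 ^ (x + 2/3 - 1) * (1 - t2) ^ (s - 1))) =
    t2 ^ (x - 1) * (1 - t2) ^ (s - 1) * (t0 ^ (x + 1/3 - 1) * (1 - t0) ^ (s - 1)) *
      (t1 ^ (x + 2/3 - 1) * (1 - t1) ^ (s - 1)) := by
  set u0 := (1 - t0) ^ (s - 1)
  set u1 := (1 - t1) ^ (s - 1)
  set u2 := (1 - t2) ^ (s - 1)
  have hsq : ∀ {t : ℝ}, 0 < t → (t ^ ((1:ℝ)/3)) ^ 2 = t ^ ((2:ℝ)/3) := fun ht => by
    rw [← rpow_natCast, ← rpow_mul ht.le]; norm_num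
  have k0 : t0 * t0 ^ (x - 1) = t0 ^ (x + 1/3 - 1) * t0 ^ ((2:ℝ)/3) := by
    rw [← rpow_add h0, mul_comm, ← rpow_add_one h0.ne']; ring_nf
  have k1 : t1 * t1 ^ (x + 1/3 - 1) = t1 ^ (x + 2/3 - 1) * t1 ^ ((2:ℝ)/3) := by
    rw [← rpow_add h1, mul_comm, ← rpow_add_one h1.ne']; ring_nf
  have k2 : t2 ^ (x + 2/3 - 1) = t2 ^ (x - 1) * t2 ^ ((2:ℝ)/3) := by
    rw [← rpow_add h2]; ring_nf
  have hp0 : 0 < t0 ^ ((2:ℝ)/3) := rpow_pos_of_pos h0 _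
  have hp1 : 0 < t1 ^ ((2:ℝ)/3) := rpow_pos_of_pos h1 _
  have hp2 : 0 < t2 ^ ((2:ℝ)/3) := rpow_pos_of_pos h2 _
  rw [geomMean_eq h0 h1 h2, mul_pow, mul_pow, hsq h0, hsq h1, hsq h2, div_mul_eq_mul_div,
    div_eq_iff (by positivity)]
  calc t0 * t1 * (t0 ^ (x - 1) * u0 * (t1 ^ (x + 1/3 - 1) * u1) * (t2 ^ (x + 2/3 - 1) * u2))
      = (t0 * t0 ^ (x - 1)) * (t1 * t1 ^ (x + 1/3 - 1)) * t2 ^ (x + 2/3 - 1) * (u0 * u1 * u2) := by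
        ring
    _ = (t0 ^ (x + 1/3 - 1) * t0 ^ ((2:ℝ)/3)) * (t1 ^ (x + 2/3 - 1) * t1 ^ ((2:ℝ)/3)) *
          (t2 ^ (x - 1) * t2 ^ ((2:ℝ)/3)) * (u0 * u1 * u2) := by rw [k0, k1, k2]
    _ = _ := by ring

/-- The shifted integrand at `p = 3`, its value written out with `Fin.prod_univ_three`. [folklore] -/
theorem shifted_apply (x s : ℚ) (t : Fin 3 → ℝ) :
    (∏ k : Fin 3, (t k) ^ ((x:ℝ) + ((k:ℕ):ℝ) / 3 - 1) * (1 - t k) ^ ((s:ℝ) - 1)) =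
      t 0 ^ ((x:ℝ) - 1) * (1 - t 0) ^ ((s:ℝ) - 1) *
        (t 1 ^ ((x:ℝ) + 1/3 - 1) * (1 - t 1) ^ ((s:ℝ) - 1)) *
        (t 2 ^ ((x:ℝ) + 2/3 - 1) * (1 - t 2) ^ ((s:ℝ) - 1)) := by
  rw [Fin.prod_univ_three]
  simp only [Fin.val_zero, Fin.val_one, Fin.val_two, Nat.cast_zero, Nat.cast_one, Nat.cast_ofNat,
    zero_div, add_zero]

/-- The rotation `finRotate 3` on indices: `0 ↦ 1`, `1 ↦ 2`, `2 ↦ 0`. [folklore] -/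
theorem finRotate_three_apply :
    (finRotate 3) 0 = 1 ∧ (finRotate 3) 1 = 2 ∧ (finRotate 3) 2 = 0 := by decide

/-- The box `(0,1)³` is stable under relabelling by a permutation. [folklore] -/
theorem reindex_domain_box (r : IntegralRep 3) (hr : r.domain = {t | ∀ i, t i ∈ Set.Ioo (0:ℝ) 1})
    (e : Fin 3 ≃ Fin 3) : (r.reindex e).domain = {t | ∀ i, t i ∈ Set.Ioo (0:ℝ) 1} := by
  ext w
  simp only [IntegralRep.reindex_domain, hr, mem_setOf_eq]
  exact ⟨fun h i => by simpa using h (e.symm i), fun h i => h (e i)⟩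

end Rotation

/-- **The rotation average** (registered sub-goal `rotationAverageThree` of `stub_gmThreeShifted`): at
`p = 3`, every box representation of the shifted integrand `f_x` is equivalent to every box
representation of `g₀ f_x`, `g₀ = (1 + t₀/ζ + t₀t₁/ζ²)/3`, `ζ = (t₀t₁t₂)^(1/3)` — since
`g₀ f_x = (f_x + f_x∘τ + f_x∘τ²)/3` for the cyclic rotation `τ`: two changes of variables (the rotations,
`KZ.of_sub_of_reindex_mem_relations`), integrand additivity, and `[σ, f] ≡ 3·[σ, f/3]`.
[cite: KontsevichZagier2001, §1.2 rules (1), (2)] -/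
theorem rotationAverageThree : ∀ (x s : ℚ), 0 < x → 0 < s → ∀ (r r₀ : KZ.IntegralRep 3),
    r.domain = {t | ∀ i, t i ∈ Set.Ioo (0:ℝ) 1} →
    Set.EqOn r.integrand (fun t => ∏ k : Fin 3,
      (t k) ^ ((x:ℝ) + ((k:ℕ):ℝ) / 3 - 1) * (1 - t k) ^ ((s:ℝ) - 1)) r.domain →
    r₀.domain = {t | ∀ i, t i ∈ Set.Ioo (0:ℝ) 1} →
    Set.EqOn r₀.integrand (fun t => (1 + t 0 / (t 0 * t 1 * t 2) ^ ((1:ℝ)/3) +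
      t 0 * t 1 / ((t 0 * t 1 * t 2) ^ ((1:ℝ)/3)) ^ 2) / 3 * ∏ k : Fin 3,
      (t k) ^ ((x:ℝ) + ((k:ℕ):ℝ) / 3 - 1) * (1 - t k) ^ ((s:ℝ) - 1)) r₀.domain →
    KZ.Equivalent r r₀ := by
  intro x s hx hs r r₀ hr hri hr₀ hr₀i
  obtain ⟨hσ0, hσ1, hσ2⟩ := Rotation.finRotate_three_apply
  have h3alg : IsAlgebraic ℚ ((3:ℝ)⁻¹) := by
    have := isAlgebraic_nat (R := ℚ) (A := ℝ) 3
    push_cast at this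
    exact this.inv
  -- `[box, f/3]` and its two rotations
  set R₃ := r.constMul ((3:ℝ)⁻¹) h3alg with hR₃
  set Rσ := R₃.reindex (finRotate 3) with hRσ
  set Rσ₂ := R₃.reindex ((finRotate 3).trans (finRotate 3)) with hRσ₂
  have hR₃d : R₃.domain = {t | ∀ i, t i ∈ Set.Ioo (0:ℝ) 1} := by rw [hR₃, IntegralRep.domain_constMul, hr]
  have hRσd : Rσ.domain = {t | ∀ i, t i ∈ Set.Ioo (0:ℝ) 1} := Rotation.reindex_domain_box R₃ hR₃d _
  have hRσ₂d : Rσ₂.domain = {t | ∀ i, t i ∈ Set.Ioo (0:ℝ) 1} := Rotation.reindex_domain_box R₃ hR₃d _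
  -- the sum of the two rotated representations
  have hSsa : IsSemialgebraicFunOn ℚ {t : Fin 3 → ℝ | ∀ i, t i ∈ Set.Ioo (0:ℝ) 1}
      (fun w => Rσ.integrand w + Rσ₂.integrand w) := by
    have h1 := Rσ.isSemialgebraicFunOn_integrand
    have h2 := Rσ₂.isSemialgebraicFunOn_integrand
    rw [hRσd] at h1
    rw [hRσ₂d] at h2
    exact h1.add_holds h2
  have hSint : IntegrableOn (fun w => Rσ.integrand w + Rσ₂.integrand w)
      {t : Fin 3 → ℝ | ∀ i, t i ∈ Set.Ioo (0:ℝ) 1} := by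
    have h1 := Rσ.integrableOn
    have h2 := Rσ₂.integrableOn
    rw [hRσd] at h1
    rw [hRσ₂d] at h2
    exact h1.add h2
  set S : IntegralRep 3 := ⟨{t | ∀ i, t i ∈ Set.Ioo (0:ℝ) 1}, fun w => Rσ.integrand w + Rσ₂.integrand w,
    isSemialgebraic_boxDom 3, hSsa, hSint⟩ with hS
  -- (1) additivity: g₀ f = f/3 + (f∘τ/3 + f∘τ²/3)
  have h1 : of r₀ - of R₃ - of S ∈ relations := by
    refine integrandAddRel_subset_relations ⟨3, r₀, R₃, S, by rw [hR₃d, hr₀], by rw [hr₀], ?_, rfl⟩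
    intro t ht
    rw [hr₀] at ht
    have ht0 : 0 < t 0 := (ht 0).1
    have ht1 : 0 < t 1 := (ht 1).1
    have ht2 : 0 < t 2 := (ht 2).1
    have htσ : (fun i => t ((finRotate 3) i)) ∈ r.domain := by rw [hr]; exact fun i => ht _
    have htσ₂ : (fun i => t (((finRotate 3).trans (finRotate 3)) i)) ∈ r.domain := by
      rw [hr]; exact fun i => ht _
    have htr : t ∈ r.domain := by rw [hr]; exact ht
    rw [hr₀i (by rw [hr₀]; exact ht)]
    simp only [Pi.add_apply, hS, hRσ, hRσ₂, hR₃, IntegralRep.reindex_integrand,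
      IntegralRep.integrand_constMul]
    rw [hri htr, hri htσ, hri htσ₂]
    simp only [Rotation.shifted_apply, Equiv.trans_apply, hσ0, hσ1, hσ2]
    rw [← Rotation.comp_eq_one (x:ℝ) (s:ℝ) ht0 ht1 ht2, ← Rotation.comp_eq_two (x:ℝ) (s:ℝ) ht0 ht1 ht2]
    ring
  -- (2) additivity: the sum representation splits into the two rotations
  have h2 : of S - of Rσ - of Rσ₂ ∈ relations :=
    integrandAddRel_subset_relations ⟨3, S, Rσ, Rσ₂, hRσd, hRσ₂d, fun _ _ => rfl, rfl⟩
  -- (3) the rotations are changes of variables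
  have h3 : of R₃ - of Rσ ∈ relations := of_sub_of_reindex_mem_relations R₃ _
  have h4 : of R₃ - of Rσ₂ ∈ relations := of_sub_of_reindex_mem_relations R₃ _
  -- (4) `[box, f] ≡ 3·[box, f/3]`
  have h5 : of (R₃.constMul ((3:ℕ):ℝ) (isAlgebraic_nat 3)) - 3 • of R₃ ∈ relations :=
    IntegralRep.of_constMul_nat_sub_nsmul_mem_relations R₃ 3
  have h6 : of r - of (R₃.constMul ((3:ℕ):ℝ) (isAlgebraic_nat 3)) ∈ relations := by
    refine of_sub_of_mem_relations_of_eqOn (by rw [IntegralRep.domain_constMul, hR₃d, hr]) fun t _ => ?_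
    simp only [hR₃, IntegralRep.integrand_constMul]
    push_cast
    ring
  have key : of r - of r₀ = (of r - of (R₃.constMul ((3:ℕ):ℝ) (isAlgebraic_nat 3))) +
      (of (R₃.constMul ((3:ℕ):ℝ) (isAlgebraic_nat 3)) - 3 • of R₃) - (of r₀ - of R₃ - of S) -
      (of S - of Rσ - of Rσ₂) + (of R₃ - of Rσ) + (of R₃ - of Rσ₂) := by
    abel
  rw [Equivalent, key]
  exact relations.add_mem (relations.add_mem (relations.sub_mem (relations.sub_mem
    (relations.add_mem h6 h5) h1) h2) h3) h4

end Summit.KontsevichZagierPeriods.TerasomaMultiplication.MultiplicationAccessible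

end
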